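import Summits.QuantumFields.YangMills.Theorems.ColdStartUniversalityLatticeLangevinTimeAverageCLT
import HarnessLib

/-!
# Route `ColdStartUniversality` (fixed-cut-off SZZ dynamics, sampler package): real-variable lemmas for the block scheme of the central
# limit theorems — `J = ⌈T/T^(1/4)⌉` blocks of length `b = T/J`, the CLT error functional, window misalignment, Gaussian exponents

Helper file (seat `ym-line-csu-p1`, g35; `--supports stmt-QuantumFields-24809`).  Pure real analysis, factored out of the CLT files (94c, 102c):
`blockScheme_facts` (`1 ≤ J`, `Jb = T`, `q/2 ≤ b ≤ q ≤ J` for `q = T^(1/4)`, `T ≥ 1`), `tendsto_blockScheme` (`b → ∞`, `1/J → 0`,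
`(2β_u + 2b)/√T → 0`, `b/√T → 0`), `tendsto_cltErrorFunctional` (the error functional of the martingale CLT tends to `0` whenever its three
inputs do), `abs_setIntegral_Ioc_sub_setIntegral_Ioc_le` (moving the endpoints of a window of a bounded integrand),
`abs_exp_neg_half_sub_le` and `abs_mul_sum_sq_mul_sub_sub_le` (comparison of Gaussian exponents).  THEOREMS ONLY; [folklore].
HONEST FRAMING: bookkeeping lemmas; nothing here concerns `UniformColdStartMixing` (24809) or the Yang–Mills mass gap, which are NOT proved.
-/

set_option autoImplicit false

noncomputable section

namespace Summit.QuantumFields.YangMills.Theorems.ColdStartUniversality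

open MeasureTheory Filter Topology Set
open scoped BigOperators

/-- The block scheme at horizon `T ≥ 1`: with `q = T^(1/4)`, `J = ⌈T/q⌉` and `b = T/J` one has `1 ≤ J`, `J·b = T`, `q/2 ≤ b ≤ q ≤ J`. [folklore] -/
theorem blockScheme_facts {T : ℝ} (hT : 1 ≤ T) :
    1 ≤ (⌈T / Real.sqrt (Real.sqrt T)⌉₊ : ℝ) ∧
    (⌈T / Real.sqrt (Real.sqrt T)⌉₊ : ℝ) * (T / (⌈T / Real.sqrt (Real.sqrt T)⌉₊ : ℝ)) = T ∧
    Real.sqrt (Real.sqrt T) / 2 ≤ T / (⌈T / Real.sqrt (Real.sqrt T)⌉₊ : ℝ) ∧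
    T / (⌈T / Real.sqrt (Real.sqrt T)⌉₊ : ℝ) ≤ Real.sqrt (Real.sqrt T) ∧
    Real.sqrt (Real.sqrt T) ≤ (⌈T / Real.sqrt (Real.sqrt T)⌉₊ : ℝ) := by
  obtain ⟨hq1, hqT, hq2⟩ := sqrt_sqrt_facts hT
  set q : ℝ := Real.sqrt (Real.sqrt T) with hq
  have hT0 : 0 < T := by linarith
  have hq0 : 0 < q := by linarith
  have hTq : 0 < T / q := div_pos hT0 hq0
  set J : ℕ := ⌈T / q⌉₊ with hJdef
  have hJge : T / q ≤ (J : ℝ) := Nat.le_ceil _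
  have hJle : (J : ℝ) ≤ T / q + 1 := (Nat.ceil_lt_add_one hTq.le).le
  have hJ0 : 0 < (J : ℝ) := hTq.trans_le hJge
  have hJne : (J : ℝ) ≠ 0 := hJ0.ne'
  have hJ1 : 1 ≤ (J : ℝ) := by
    have : (1 : ℕ) ≤ J := Nat.one_le_iff_ne_zero.2 (by
      intro h0; have : (J : ℝ) = 0 := by exact_mod_cast h0
      linarith)
    exact_mod_cast this
  refine ⟨hJ1, by field_simp, ?_, ?_, ?_⟩
  · -- `b ≥ q/2` from `J ≤ T/q + 1 ≤ 2T/q`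
    have h2 : T / q + 1 ≤ 2 * T / q := by
      rw [div_add_one hq0.ne', div_le_div_iff₀ hq0 hq0]; nlinarith [hqT, hq0]
    rw [div_le_div_iff₀ (by norm_num : (0 : ℝ) < 2) hJ0]
    calc q * (J : ℝ) ≤ q * (2 * T / q) := mul_le_mul_of_nonneg_left (hJle.trans h2) hq0.le
      _ = T * 2 := by field_simp
  · -- `b ≤ q` from `J ≥ T/q`
    rw [div_le_iff₀ hJ0]
    calc T = q * (T / q) := by field_simp
      _ ≤ q * (J : ℝ) := mul_le_mul_of_nonneg_left hJge hq0.le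
  · -- `q ≤ J` from `T/q = q³ ≥ q`
    refine le_trans ?_ hJge
    rw [le_div_iff₀ hq0]
    have hq4 : q ^ 4 = T := by
      have : q ^ 4 = (q ^ 2) ^ 2 := by ring
      rw [this, hq2, Real.sq_sqrt hT0.le]
    nlinarith [hq4, hq1]

/-- Limits of the block scheme as `T → ∞`: the block length `b = T/⌈T/T^(1/4)⌉ → ∞`, `1/J → 0`, the increment bound `(2β_u + 2b)/√T → 0`, and
`b/√T → 0`. [folklore] -/
theorem tendsto_blockScheme (βu : ℝ) :
    Tendsto (fun T : ℝ => T / (⌈T / Real.sqrt (Real.sqrt T)⌉₊ : ℝ)) atTop atTop ∧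
    Tendsto (fun T : ℝ => ((⌈T / Real.sqrt (Real.sqrt T)⌉₊ : ℕ) : ℝ)⁻¹) atTop (𝓝 0) ∧
    Tendsto (fun T : ℝ => (2 * βu + 2 * (T / (⌈T / Real.sqrt (Real.sqrt T)⌉₊ : ℝ))) / Real.sqrt T) atTop (𝓝 0) ∧
    Tendsto (fun T : ℝ => T / (⌈T / Real.sqrt (Real.sqrt T)⌉₊ : ℝ) * (Real.sqrt T)⁻¹) atTop (𝓝 0) := by
  set q : ℝ → ℝ := fun T => Real.sqrt (Real.sqrt T) with hq
  set Jf : ℝ → ℕ := fun T => ⌈T / q T⌉₊ with hJf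
  set bf : ℝ → ℝ := fun T => T / (Jf T : ℝ) with hbf
  show Tendsto bf atTop atTop ∧ Tendsto (fun T => (Jf T : ℝ)⁻¹) atTop (𝓝 0) ∧
    Tendsto (fun T => (2 * βu + 2 * bf T) / Real.sqrt T) atTop (𝓝 0) ∧ Tendsto (fun T => bf T * (Real.sqrt T)⁻¹) atTop (𝓝 0)
  have hfacts : ∀ T : ℝ, 1 ≤ T → 1 ≤ (Jf T : ℝ) ∧ (Jf T : ℝ) * bf T = T ∧ q T / 2 ≤ bf T ∧ bf T ≤ q T ∧ q T ≤ (Jf T : ℝ) :=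
    fun T hT => blockScheme_facts hT
  have hq_top : Tendsto q atTop atTop := Real.tendsto_sqrt_atTop.comp Real.tendsto_sqrt_atTop
  have hsqrt_inv : Tendsto (fun T : ℝ => (Real.sqrt T)⁻¹) atTop (𝓝 0) := tendsto_inv_atTop_zero.comp Real.tendsto_sqrt_atTop
  have hq_inv : Tendsto (fun T : ℝ => (q T)⁻¹) atTop (𝓝 0) := tendsto_inv_atTop_zero.comp hq_top
  have hq0 : ∀ T : ℝ, 1 ≤ T → 0 < q T := fun T hT => by have := (sqrt_sqrt_facts hT).1; simp only [hq]; linarith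
  have hsT : ∀ T : ℝ, 1 ≤ T → Real.sqrt T = q T * q T := fun T hT => by
    have hq2 := (sqrt_sqrt_facts hT).2.2
    simp only [hq]; rw [← pow_two]; exact hq2.symm
  have hb_top : Tendsto bf atTop atTop := by
    refine tendsto_atTop_mono' atTop ?_ (hq_top.atTop_div_const (by norm_num : (0 : ℝ) < 2))
    filter_upwards [eventually_ge_atTop (1 : ℝ)] with T hT
    exact (hfacts T hT).2.2.1
  have hJ : Tendsto (fun T => (Jf T : ℝ)⁻¹) atTop (𝓝 0) := by
    refine tendsto_of_tendsto_of_tendsto_of_le_of_le' tendsto_const_nhds hq_inv ?_ ?_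
    · filter_upwards [eventually_ge_atTop (1 : ℝ)] with T hT
      exact inv_nonneg.2 (by have := (hfacts T hT).1; linarith)
    · filter_upwards [eventually_ge_atTop (1 : ℝ)] with T hT
      exact inv_anti₀ (hq0 T hT) (hfacts T hT).2.2.2.2
  have htb : Tendsto (fun T : ℝ => bf T * (Real.sqrt T)⁻¹) atTop (𝓝 0) := by
    refine tendsto_of_tendsto_of_tendsto_of_le_of_le' tendsto_const_nhds hq_inv ?_ ?_
    · filter_upwards [eventually_ge_atTop (1 : ℝ)] with T hT
      have hb0 : 0 ≤ bf T := by have := (hfacts T hT).2.2.1; have := hq0 T hT; linarith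
      exact mul_nonneg hb0 (inv_nonneg.2 (Real.sqrt_nonneg _))
    · filter_upwards [eventually_ge_atTop (1 : ℝ)] with T hT
      have hbq := (hfacts T hT).2.2.2.1
      have hq0' := hq0 T hT
      rw [hsT T hT, mul_inv, ← mul_assoc]
      calc bf T * (q T)⁻¹ * (q T)⁻¹ ≤ q T * (q T)⁻¹ * (q T)⁻¹ := by gcongr
        _ = (q T)⁻¹ := by rw [mul_inv_cancel₀ hq0'.ne', one_mul]
  have hB : Tendsto (fun T => (2 * βu + 2 * bf T) / Real.sqrt T) atTop (𝓝 0) := by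
    have e : ∀ T, (2 * βu + 2 * bf T) / Real.sqrt T = 2 * βu * (Real.sqrt T)⁻¹ + 2 * (bf T * (Real.sqrt T)⁻¹) := fun T => by ring
    simp_rw [e]
    simpa using (hsqrt_inv.const_mul (2 * βu)).add (htb.const_mul 2)
  exact ⟨hb_top, hJ, hB, htb⟩

/-- The error functional of the martingale CLT (files 92c/94b) tends to `0` as soon as its inputs `E(T)` (variance defect per unit length),
`B(T)` (increment bound) and `1/J(T)` do. [folklore] -/
theorem tendsto_cltErrorFunctional (σ2 βu θ : ℝ) {E B Ji : ℝ → ℝ} (hE : Tendsto E atTop (𝓝 0)) (hB : Tendsto B atTop (𝓝 0))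
    (hJ : Tendsto Ji atTop (𝓝 0)) :
    Tendsto (fun T : ℝ => Real.exp (θ ^ 2 * σ2 / 2) * (θ ^ 2 * E T + |θ| ^ 3 * Real.exp (|θ| * B T) * B T * (σ2 + E T) +
      θ ^ 4 * σ2 ^ 2 / 4 * Ji T + (|θ| * B T + θ ^ 2 * B T ^ 2 / 2) * (θ ^ 2 * σ2 / 2)) + |θ| * (2 * βu) * (Real.sqrt T)⁻¹)
      atTop (𝓝 0) := by
  have hsqrt_inv : Tendsto (fun T : ℝ => (Real.sqrt T)⁻¹) atTop (𝓝 0) := tendsto_inv_atTop_zero.comp Real.tendsto_sqrt_atTop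
  have hexpB : Tendsto (fun T => Real.exp (|θ| * B T)) atTop (𝓝 1) := by
    have h0 : Tendsto (fun T => |θ| * B T) atTop (𝓝 0) := by simpa using hB.const_mul |θ|
    have := (Real.continuous_exp.tendsto 0).comp h0
    rw [Real.exp_zero] at this
    exact this
  have h1 := hE.const_mul (θ ^ 2)
  have h2 := ((hexpB.const_mul (|θ| ^ 3)).mul hB).mul (hE.const_add σ2)
  have h3 := hJ.const_mul (θ ^ 4 * σ2 ^ 2 / 4)
  have h4 := ((hB.const_mul |θ|).add ((hB.pow 2).const_mul (θ ^ 2) |>.div_const 2)).mul_const (θ ^ 2 * σ2 / 2)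
  have h5 := hsqrt_inv.const_mul (|θ| * (2 * βu))
  have hall := ((((h1.add h2).add h3).add h4).const_mul (Real.exp (θ ^ 2 * σ2 / 2))).add h5
  simp only [mul_zero, zero_mul, add_zero, mul_one, zero_pow two_ne_zero, zero_div] at hall
  exact hall

/-- Moving the endpoints of a window: for an integrand bounded by `B` (and integrable on bounded intervals),
`|∫_(lo,hi] f − ∫_(lo',hi'] f| ≤ B(|hi − hi'| + |lo − lo'|)`. [folklore] -/
theorem abs_setIntegral_Ioc_sub_setIntegral_Ioc_le {f : ℝ → ℝ} {B : ℝ} (hf : ∀ y, IntegrableOn f (Ioc 0 y)) (hB : ∀ r, |f r| ≤ B)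
    {lo hi lo' hi' : ℝ} (hlo : 0 ≤ lo) (hle : lo ≤ hi) (hlo' : 0 ≤ lo') (hle' : lo' ≤ hi') :
    |(∫ r in Ioc lo hi, f r) - ∫ r in Ioc lo' hi', f r| ≤ B * (|hi - hi'| + |lo - lo'|) := by
  have hdiff : ∀ lo hi : ℝ, 0 ≤ lo → lo ≤ hi → ∫ r in Ioc lo hi, f r = (∫ r in Ioc 0 hi, f r) - ∫ r in Ioc 0 lo, f r := by
    intro lo hi hlo hle
    rw [← Ioc_union_Ioc_eq_Ioc hlo hle, setIntegral_union (Ioc_disjoint_Ioc_of_le le_rfl) measurableSet_Ioc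
      ((hf hi).mono_set (Ioc_subset_Ioc_right hle)) ((hf hi).mono_set (Ioc_subset_Ioc_left hlo))]
    ring
  have hlip : ∀ y y' : ℝ, 0 ≤ y → 0 ≤ y' → |(∫ r in Ioc 0 y, f r) - ∫ r in Ioc 0 y', f r| ≤ B * |y - y'| := by
    intro y y' hy hy'
    wlog hyy : y' ≤ y generalizing y y'
    · have h := this y' y hy' hy (le_of_not_ge hyy)
      rwa [abs_sub_comm, abs_sub_comm y' y] at h
    rw [← hdiff y' y hy' hyy, abs_of_nonneg (by linarith : 0 ≤ y - y')]
    have hh := norm_setIntegral_le_of_norm_le_const (μ := volume) (s := Ioc y' y) measure_Ioc_lt_top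
      (fun r _ => show ‖f r‖ ≤ B by rw [Real.norm_eq_abs]; exact hB r)
    rw [Real.norm_eq_abs, Real.volume_real_Ioc_of_le hyy] at hh
    linarith
  rw [hdiff lo hi hlo hle, hdiff lo' hi' hlo' hle']
  have e : (∫ r in Ioc 0 hi, f r) - (∫ r in Ioc 0 lo, f r) - ((∫ r in Ioc 0 hi', f r) - ∫ r in Ioc 0 lo', f r) =
      ((∫ r in Ioc 0 hi, f r) - ∫ r in Ioc 0 hi', f r) - ((∫ r in Ioc 0 lo, f r) - ∫ r in Ioc 0 lo', f r) := by ring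
  rw [e, mul_add]
  exact (abs_sub _ _).trans (add_le_add (hlip hi hi' (hlo.trans hle) (hlo'.trans hle')) (hlip lo lo' hlo hlo'))

/-- Gaussian exponents are `1/2`-Lipschitz in the variance: `|e^{−u/2} − e^{−w/2}| ≤ |u − w|/2` for `u, w ≥ 0`. [folklore] -/
theorem abs_exp_neg_half_sub_le {u w : ℝ} (hu : 0 ≤ u) (hw : 0 ≤ w) :
    |Real.exp (-(u / 2)) - Real.exp (-(w / 2))| ≤ |u - w| / 2 := by
  wlog hle : w ≤ u generalizing u w
  · have h := this hw hu (le_of_not_ge hle); rwa [abs_sub_comm, abs_sub_comm w u] at h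
  have h1 : Real.exp (-(u / 2)) ≤ Real.exp (-(w / 2)) := Real.exp_le_exp.2 (by linarith)
  rw [abs_of_nonpos (sub_nonpos.2 h1), abs_of_nonneg (sub_nonneg.2 hle)]
  have h2 := Real.add_one_le_exp (-(u / 2) - -(w / 2))
  have h3 : Real.exp (-(u / 2)) = Real.exp (-(w / 2)) * Real.exp (-(u / 2) - -(w / 2)) := by rw [← Real.exp_add]; ring_nf
  have h4 : Real.exp (-(w / 2)) ≤ 1 := Real.exp_le_one_iff.2 (by linarith)
  nlinarith [Real.exp_pos (-(w / 2)), Real.exp_pos (-(u / 2) - -(w / 2))]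

/-- Comparison of two quadratic forms `σ² Σ aᵢ²(k_{i+1} − k_i)` and `σ² Σ aᵢ²(s_{i+1} − s_i)` when `|k_i − s_i| ≤ ε` for all `i`. [folklore] -/
theorem abs_mul_sum_sq_mul_sub_sub_le {m : ℕ} {σ2 ε : ℝ} (hσ : 0 ≤ σ2) (a : Fin m → ℝ) (k s : ℕ → ℝ) (hk : ∀ i, |k i - s i| ≤ ε) :
    |σ2 * (∑ i : Fin m, a i ^ 2 * (k ((i : ℕ) + 1) - k i)) - σ2 * ∑ i : Fin m, a i ^ 2 * (s ((i : ℕ) + 1) - s i)| ≤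
      2 * σ2 * (∑ i : Fin m, a i ^ 2) * ε := by
  rw [← mul_sub, ← Finset.sum_sub_distrib, abs_mul, abs_of_nonneg hσ]
  have hterm : ∀ i : Fin m, |a i ^ 2 * (k ((i : ℕ) + 1) - k i) - a i ^ 2 * (s ((i : ℕ) + 1) - s i)| ≤ a i ^ 2 * (2 * ε) := fun i => by
    rw [← mul_sub, abs_mul, abs_of_nonneg (sq_nonneg _)]
    refine mul_le_mul_of_nonneg_left ?_ (sq_nonneg _)
    have e : k ((i : ℕ) + 1) - k i - (s ((i : ℕ) + 1) - s i) = (k ((i : ℕ) + 1) - s ((i : ℕ) + 1)) - (k i - s i) := by ring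
    rw [e]
    exact (abs_sub _ _).trans (by linarith [hk ((i : ℕ) + 1), hk i])
  calc σ2 * |∑ i : Fin m, (a i ^ 2 * (k ((i : ℕ) + 1) - k i) - a i ^ 2 * (s ((i : ℕ) + 1) - s i))|
      ≤ σ2 * ∑ i : Fin m, a i ^ 2 * (2 * ε) :=
        mul_le_mul_of_nonneg_left ((Finset.abs_sum_le_sum_abs _ _).trans (Finset.sum_le_sum fun i _ => hterm i)) hσ
    _ = 2 * σ2 * (∑ i : Fin m, a i ^ 2) * ε := by rw [← Finset.sum_mul]; ring

end Summit.QuantumFields.YangMills.Theorems.ColdStartUniversality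

end
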